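import Literature.NumberTheory.DiophantineGeometry.AbcWave0
import Mathlib.NumberTheory.Height.NumberField
import HarnessLib

/-!
# Scoones 2021/2023: `log H(a, b, c) < G^{1/3 + o(1)}` — an unconditional abc-type inequality in a FIXED number field

Topic `Literature/NumberTheory/DiophantineGeometry`; namespace `Literature.NumberTheory.DiophantineGeometry`.
ONE NAMED FACT (D-0014, D-0026: `def … : Prop`, no proof in the tree, no instance, no notation). Typed ≠ proved;
a named fact is a hypothesis `(h : scoones2021_abcNumberField_classNumberOne)`, not a theorem of ours.

Source. A. Scoones, *On the abc Conjecture in Algebraic Number Fields*, arXiv:2111.07791 (Nov 2021, the HELD text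
`paper:arxiv-2111.07791`, whose numbering is used below: set-up p. 3, Theorems 1–3 and the display after Theorem 3
on p. 4, proof of Theorem 3 in §5 pp. 20–21); published version: Mathematika **70** (2023), no. 1 [Scoones2023]
(`references.bib` records it as refereed; this seat read the arXiv text only — the statement typed here is as printed
there; the identical statements are Thm. 2.1.3.3 / eq. (2.5) of the author's York thesis 2023, held as
`paper:galaxy-pdf-4555882797610083340`, p. 26). Method: Baker-type `S`-unit bounds over the Hilbert class field
(Győry–Yu 2006) with Le Fourn's "tubular" refinement (third-largest prime of `S`), i.e. Stewart–Yu 2001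
(`stewart_yu`, exponent `1/3` over `ℚ`) transported to number fields.

PRINTED SET-UP (p. 3, verbatim): "Let `K` be a number field of degree `d` and let `a, b, c ∈ 𝓞_K ∖ {0}` be such that
`a + b + c = 0`. Further, assume that `a𝓞_K, b𝓞_K` and `c𝓞_K` are pairwise coprime; that is `a𝓞_K + b𝓞_K = 𝓞_K`,
and similarly for all other pairs. Let `L = HCF(K)` be the Hilbert Class Field of `K` … and let
`G = ∏_{𝔓 prime ideal, 𝔓 ⊂ 𝓞_L, 𝔓 ∣ (abc)𝓞_L} Nm^L_ℚ(𝔓)`." Heights: "`H_F(x₁, …, xₙ) = ∏_{υ ∈ M_F} max{|x₁|_υ, …,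
|xₙ|_υ}`", "`M_F` the set of places of the number field `F` normalised so they satisfy the product formula", "the
projective height". PRINTED THEOREM 3 (p. 4): "Given the set up above, there exists an effectively computable
constant `𝒞₁₀` depending on `K` such that `log H_L(a, b, c) < (Nm 𝔭_a · Nm 𝔭_b · Nm 𝔭_c · Nm 𝔭_c′ · Nm 𝔮)^{1/3}
· G^{𝒞₁₀ log log log G / log log G}`, where `𝔭_c′` is the prime ideal of third largest norm dividing `c𝓞_L` and `𝔮`
is the prime ideal of `𝓞_L` of third largest norm dividing `bc𝓞_L`" [`𝔭_a, 𝔭_b, 𝔭_c` = the primes of `𝓞_L` of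
greatest norm dividing `a𝓞_L, b𝓞_L, c𝓞_L`], and the DISPLAY deduced from it (p. 4; §5 p. 21; abstract): "From
here we will deduce that `log H_L(a, b, c) < G^{1/3 + 𝒞₁₁ log log log G / log log G}`."

WHAT IS TYPED (`scoones2021_abcNumberField_classNumberOne`), and the three rendering decisions.
(1) CLASS NUMBER ONE ONLY: the hypothesis `IsPrincipalIdealRing (𝓞 K)` (an explicit binder, not an instance) makes
`L = HCF(K) = K`, so heights and `G` live on `K` itself; Mathlib has no Hilbert class field, and the consumers
(`K = ℚ(i)`, `ℚ(√5)`) have `h_K = 1`. The general form is NOT typed. (Over `K` with `h_K > 1` the printed bound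
is genuinely weaker when expressed on `K`: every prime `𝔭 ∣ abc` of `K` is unramified in `L` with
`∏_{𝔓 ∣ 𝔭} Nm 𝔓 = Nm 𝔭^{h_K}`, so `G = G_K^{h_K}`; do not drop the binder.)
(2) `G` IS THE TREE'S `radicalNorm` (Granville–Stark conductor, `AbcWave0.lean`: `∏ᶠ` of `Ideal.absNorm` over
`badPrimes a b c` = the primes at which the valuations of `a, b, c` are not all equal), EACH PRIME ONCE, NO
ramification exponent — so it is NOT Győry's `radicalK` (`AbcGyory2008NumberFields.lean`, `∏ N𝔭^{e(𝔭|p)}`). For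
`a, b, c ∈ 𝓞_K ∖ {0}` with pairwise coprime principal ideals a prime `𝔭` has at most one of `ord_𝔭 a, ord_𝔭 b,
ord_𝔭 c` positive, hence `𝔭 ∈ badPrimes a b c ↔ 𝔭 ∣ abc`, and `radicalNorm a b c = ∏_{𝔭 ∣ abc𝓞_K} Nm 𝔭 = G`
(`= Ideal.absNorm` of the radical of `abc𝓞_K`). Cost bookkeeping for consumers: a rational prime `p ∣ Nm(abc)`
contributes `Nm 𝔭 = p^{f(𝔭|p)}` for EACH prime `𝔭 ∣ abc` above it (inert in a quadratic field: `p²`; split with both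
conjugates dividing `abc`: `p · p`; ramified: `p`).
(3) `H` IS MATHLIB'S RELATIVE PROJECTIVE HEIGHT `Height.mulHeight ![a, b, c]` over `K` (archimedean places with
multiplicity `1`/`2`, finite places `|x|_𝔭 = Nm 𝔭^{−ord_𝔭 x}`, product formula: `NumberField.instAdmissibleAbsValues`;
the normalisation recorded for `UniformABCConjecture` and `gyory2008_thm1` in this directory), typed through
`Height.logHeight = Real.log ∘ Height.mulHeight`. For pairwise coprime INTEGERS the finite factors are `1`, so
`H_K(a, b, c) = ∏_{σ : K → ℂ} max(|σa|, |σb|, |σc|)`. Scoones' `H_L` is "the projective height" with places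
"normalised so they satisfy the product formula" and `h(x) = d h_K log H_L(1, x)` (p. 3); whichever of the two
standard normalisations (absolute, or relative to `L = K`) is meant, `log` of one is `[K:ℚ]` times `log` of the other,
and the factor is absorbed in the constant `C = C(K, ε)` below — the typed sentence is implied either way.
(4) ε-FORM: the printed exponent `1/3 + 𝒞₁₁ log log log G / log log G` is an `o(1)`-perturbation of `1/3` that is only
meaningful for large `G` (the proofs run "for a sufficiently large constant and large enough `G`", thesis p. 45,
(3.88); for `G ≤ 15 < e^e` the triple logarithm is not even positive). Typed is the consequence every consumer
uses: for every `ε > 0` a constant `C = C(K, ε) > 0` with `log H_K(a, b, c) ≤ C · G^{1/3 + ε}` for ALL admissible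
triples. For `G ≥ G₀(K, ε)` this is the display with `𝒞₁₁ log log log G / log log G ≤ ε`; for `G < G₀` there are
finitely many sets `S` of primes of norm `< G₀`, for each of which `(a/c, b/c)` runs over the finitely many solutions
of the `S`-unit equation `x + y = −1` (Siegel–Mahler; effectively Győry–Yu, the very bounds the paper uses), and
`H_K(a, b, c) = H_K(a/c, b/c, 1)` — so these heights are bounded and absorbed in `C`. The effectivity of `𝒞₁₁`
and of `C` is NOT transcribed (existence only: weaker than print). The literal triple-log form is not typed.
Side conditions are exactly the printed ones: `a, b, c ∈ 𝓞_K`, all `≠ 0`, `a + b + c = 0`, PAIRWISE coprime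
(`IsCoprime` in `𝓞 K`, i.e. `a𝓞_K + b𝓞_K = 𝓞_K`; given `a + b + c = 0` any one of the three pairwise conditions
implies the other two, but all three are kept as printed); nothing sharper than print is asserted.

CONSUMERS («one fact, two class rows»; both at abc distance 0, NOT abc, NOT A-PS): the ℤ-shadows
`Summit.ABC.ABC.Theses.GaussianTwoDivision.GaussianNormTripleBound` (stmt-ABC-23401, `K = ℚ(i)`, exponent `2/3`) and
`Summit.ABC.ABC.Theses.CuspFieldPencil.GoldenCuspShadow` / `NFPencilBound` (stmt-ABC-26026 / 26250, `K = ℚ(√5)`,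
exponent `1/2`), which take this fact BY NAME as a hypothesis; the fact proves neither by itself (the dictionary from
their integer data to a pairwise-coprime `𝓞_K`-triple, the height comparison `log max|u|,|w| ≤ log H_K + O(1)` and
the prime-cost count `G ≤ c · rad^{3/2}` resp. `rad²` are prover work). For `K = ℚ` the sentence is implied by
Stewart–Yu 2001 (`stewart_yu`, `Literature.Barriers.ABC.BakerMethodBounds`: `log c ≪ rad^{1/3} (log rad)³`).

HONESTY. An unconditional theorem in print, typed as a cite-only named fact (debt +1); it is exponentially far from
abc (`log H` vs. `H`), moves no rung of the abc ladder, and says nothing about A-PS. The paper's own Remark (p. 5)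
on the Mochizuki–Fesenko–Hoshi–Minamide–Porowski inequality ("relies on … Inter-universal Teichmüller Theory, the
veracity of which is currently being debated") is recorded in `references.bib` [Scoones2023]; no side is taken here.
-/

namespace Literature.NumberTheory.DiophantineGeometry

open NumberField

/-- **Scoones 2021 (arXiv:2111.07791; Mathematika 70 (2023)), Theorem 3 and the display following it (p. 4),
CLASS-NUMBER-ONE case, ε-form.** Printed: for a number field `K`, `a, b, c ∈ 𝓞_K ∖ {0}` with `a + b + c = 0` and
`a𝓞_K, b𝓞_K, c𝓞_K` pairwise coprime, `L = HCF(K)`, `G = ∏_{𝔓 ∣ abc𝓞_L} Nm^L_ℚ 𝔓`: "there exists an effectively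
computable constant `𝒞₁₀` depending on `K` such that `log H_L(a, b, c) < (Nm 𝔭_a Nm 𝔭_b Nm 𝔭_c Nm 𝔭_c′ Nm 𝔮)^{1/3}
G^{𝒞₁₀ log log log G / log log G}` … From here we will deduce that `log H_L(a, b, c) < G^{1/3 + 𝒞₁₁ log log log G /
log log G}`." Typed (see the module docstring, decisions (1)–(4)): when `𝓞 K` is a principal ideal ring (`h_K = 1`,
so `L = K`), for every `ε > 0` there is `C > 0` (depending on `K`, `ε`) such that for all pairwise coprime nonzero
`a, b, c ∈ 𝓞 K` with `a + b + c = 0`,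
`log H_K(a : b : c) ≤ C · (radicalNorm a b c)^{1/3 + ε}`, with `H_K = Height.mulHeight ![a, b, c]` (Mathlib's
relative projective height over `K`) and `radicalNorm a b c = ∏_{𝔭 ∣ abc} Nm 𝔭 = G` (each prime once). The `o(1)` in
the exponent, the small-`G` range and the height normalisation are absorbed in `C`; effectivity is not transcribed.
Named fact, no proof in the tree (Baker's method over number fields). Unconditional in print; NOT abc (a bound for
`log H`, not `H`). [cite: Scoones2023, Thm 3 + display p. 4 (arXiv:2111.07791v1 numbering); §5 p. 21] -/
def scoones2021_abcNumberField_classNumberOne : Prop :=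
  ∀ (K : Type) [Field K] [NumberField K], IsPrincipalIdealRing (𝓞 K) →
    ∀ ε : ℝ, 0 < ε → ∃ C : ℝ, 0 < C ∧
      ∀ a b c : 𝓞 K, a ≠ 0 → b ≠ 0 → c ≠ 0 → a + b + c = 0 →
        IsCoprime a b → IsCoprime b c → IsCoprime c a →
          Height.logHeight ![(a : K), (b : K), (c : K)] ≤
            C * (radicalNorm (a : K) (b : K) (c : K) : ℝ) ^ (1 / 3 + ε : ℝ)

end Literature.NumberTheory.DiophantineGeometry
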